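import Mathlib.MeasureTheory.Measure.Haar.Basic
import Mathlib.MeasureTheory.Integral.DominatedConvergence
import Mathlib.MeasureTheory.Group.Integral
import Mathlib.Topology.Algebra.Group.Compact
import Mathlib.Topology.UrysohnsLemma
import HarnessLib

/-!
# Averaging over a compact subgroup; invariant bump functions

Trunk `AutomorphicAxiomatic` (G19), topic `NumberTheory/Automorphic`; namespace `Literature.Automorphic`.
Mathlib-only input for the smoothing of `L²`-automorphic forms by *level-invariant* weights
(`InvariantMeasureDomination.orbitalSmoothing` with a weight `η` satisfying `η(k g) = η(g)` for
`k` in a compact level subgroup `K ≤ G(𝔸_K)`, so that the smoothing of a `K`-fixed vector is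
again `K`-fixed):

* `subgroupHaar K hK = haarMeasure ⊤` — the Haar probability measure of a compact subgroup `K ≤ G`
  (the tree's idiom for "the Haar probability of a compact group": it is *syntactically*
  `Measure.haarMeasure ⊤`, as in `Literature.MathematicalPhysics.QuantumFieldTheory.haarProbability`
  (`MathematicalPhysics/QuantumFieldTheory/ConstructiveQFTWave0`) and
  `isProbabilityMeasure_haarMeasure_top` (`RepresentationTheory/CompactGroups/UnitaryTrick`), which
  are not imported here only because those files are off-topic and import Mathlib wholesale; the
  wrapper exists to package the hypothesis `hK : IsCompact K`, which supplies the `CompactSpace K`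
  instance making `⊤ : PositiveCompacts K` available);
* `subgroupAverage K hK η (g) = ∫_K η(k⁻¹ g) dk` — left `K`-invariant (`subgroupAverage_mul_left`),
  non-negative for `η ≥ 0`, continuous for continuous compactly supported `η`
  (`continuous_subgroupAverage`), compactly supported (`hasCompactSupport_subgroupAverage`, support
  in `K · tsupport η`), positive where `η` is (`subgroupAverage_pos`);
* `exists_continuous_invariant_nonneg_pos` — for every open `U ⊇ K` a continuous compactly
  supported `η ≥ 0`, left `K`-invariant, with `η(1) > 0` and `support η ⊆ U` (Urysohn after
  `compact_open_separated_mul_right`); positivity of `∫ η` is then Mathlib's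
  `Continuous.integral_pos_of_hasCompactSupport_nonneg_nonzero`.

All statements are standard (tagged folklore); Mathlib has the ingredients (`haarMeasure`,
`integral_mul_left_eq_self`, `continuous_of_dominated`, `exists_continuous_one_zero_of_isCompact`)
but not the packaged averaging operator (`lean search 'subgroupAverage|average.*Subgroup'`: none).
-/

open MeasureTheory Measure Set Filter Topology
open scoped Pointwise

namespace Literature.NumberTheory.Automorphic

noncomputable section

section Averaging

variable {G : Type*} [Group G] [TopologicalSpace G] [IsTopologicalGroup G]
  [MeasurableSpace G] [BorelSpace G]
  (K : Subgroup G)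

omit [IsTopologicalGroup G] [MeasurableSpace G] [BorelSpace G] in
/-- A compact subgroup is a compact space (a one-line helper, Mathlib `isCompact_iff_compactSpace`,
used below only through `haveI` to make `⊤ : PositiveCompacts K` available). [folklore] -/
theorem compactSpace_subgroup (hK : IsCompact (K : Set G)) : CompactSpace K :=
  isCompact_iff_compactSpace.1 hK

variable (hK : IsCompact (K : Set G))

/-- The **Haar probability measure** `haarMeasure ⊤` of a compact subgroup `K ≤ G` (as a compact
group with the subspace topology; the tree's idiom `Measure.haarMeasure ⊤`, cf.
`Literature.MathematicalPhysics.QuantumFieldTheory.haarProbability`, here packaged with the compactness hypothesis `hK` that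
provides `⊤ : PositiveCompacts K`). [folklore] -/
def subgroupHaar : Measure K :=
  haveI := compactSpace_subgroup K hK
  Measure.haarMeasure (⊤ : TopologicalSpace.PositiveCompacts K)

/-- `subgroupHaar` is a Haar measure (instance on a term of this file only). [folklore] -/
instance isHaarMeasure_subgroupHaar : (subgroupHaar K hK).IsHaarMeasure := by
  haveI := compactSpace_subgroup K hK
  unfold subgroupHaar
  infer_instance

/-- `subgroupHaar` is a probability measure (instance on a term of this file only; the same
one-liner as `isProbabilityMeasure_haarMeasure_top` of `RepresentationTheory/CompactGroups`).
[folklore] -/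
instance isProbabilityMeasure_subgroupHaar : IsProbabilityMeasure (subgroupHaar K hK) := by
  haveI := compactSpace_subgroup K hK
  exact ⟨by simpa [subgroupHaar] using (Measure.haarMeasure_self (G := K) (K₀ := ⊤))⟩

/-- The **`K`-average** of a function `η` on `G` over a compact subgroup `K`:
`(avg η)(g) = ∫_K η(k⁻¹ g) dk` (Haar probability measure of `K`). [folklore] -/
def subgroupAverage (η : G → ℝ) (g : G) : ℝ :=
  ∫ k : K, η ((k : G)⁻¹ * g) ∂(subgroupHaar K hK)

/-- Unfolding of `subgroupAverage`. [folklore] -/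
theorem subgroupAverage_apply (η : G → ℝ) (g : G) :
    subgroupAverage K hK η g = ∫ k : K, η ((k : G)⁻¹ * g) ∂(subgroupHaar K hK) := rfl

/-- The `K`-average is left `K`-invariant. [folklore] -/
theorem subgroupAverage_mul_left (η : G → ℝ) {k₀ : G} (hk₀ : k₀ ∈ K) (g : G) :
    subgroupAverage K hK η (k₀ * g) = subgroupAverage K hK η g := by
  rw [subgroupAverage_apply, subgroupAverage_apply]
  have := integral_mul_left_eq_self (μ := subgroupHaar K hK)
    (fun k : K => η ((k : G)⁻¹ * g)) (⟨k₀, hk₀⟩⁻¹ : K)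
  rw [← this]
  congr 1 with k
  simp [mul_assoc]

/-- The `K`-average of a non-negative function is non-negative. [folklore] -/
theorem subgroupAverage_nonneg {η : G → ℝ} (hη : 0 ≤ η) (g : G) : 0 ≤ subgroupAverage K hK η g :=
  integral_nonneg fun _ => hη _

/-- The `K`-average of a continuous function is continuous (dominated convergence on the finite
measure of `K`, with the bound `sup |η|` on a neighbourhood when `η` has compact support).
[folklore] -/
theorem continuous_subgroupAverage [FirstCountableTopology G] {η : G → ℝ} (hη : Continuous η)
    (hηs : HasCompactSupport η) : Continuous (subgroupAverage K hK η) := by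
  obtain ⟨M, hM⟩ := hη.bounded_above_of_compact_support hηs
  refine continuous_of_dominated (bound := fun _ => M) ?_ ?_ (integrable_const M) ?_
  · intro g
    exact ((hη.comp ((continuous_subtype_val.inv).mul continuous_const)).aestronglyMeasurable)
  · intro g
    exact Eventually.of_forall fun k => hM _
  · exact Eventually.of_forall fun k => hη.comp ((continuous_const).mul continuous_id)

/-- The support of the `K`-average lies in `K · tsupport η`. [folklore] -/
theorem subgroupAverage_eq_zero_of_notMem {η : G → ℝ} {g : G}
    (hg : g ∉ (K : Set G) * tsupport η) : subgroupAverage K hK η g = 0 := by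
  rw [subgroupAverage_apply]
  refine integral_eq_zero_of_ae (Eventually.of_forall fun k => ?_)
  have : (k : G)⁻¹ * g ∉ tsupport η := by
    intro hmem
    exact hg ⟨k, k.2, (k : G)⁻¹ * g, hmem, by simp⟩
  exact image_eq_zero_of_notMem_tsupport this

/-- The `K`-average of a compactly supported function is compactly supported. [folklore] -/
theorem hasCompactSupport_subgroupAverage {η : G → ℝ} (hηs : HasCompactSupport η) :
    HasCompactSupport (subgroupAverage K hK η) := by
  refine HasCompactSupport.of_support_subset_isCompact (hK.mul hηs) fun g hg => ?_
  by_contra h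
  exact hg (subgroupAverage_eq_zero_of_notMem K hK h)

/-- If `η ≥ 0` is continuous and `η(g₀) > 0` then the `K`-average is positive at `g₀`. [folklore] -/
theorem subgroupAverage_pos {η : G → ℝ} (hη : Continuous η) (hη0 : 0 ≤ η) {g₀ : G}
    (hg₀ : 0 < η g₀) : 0 < subgroupAverage K hK η g₀ := by
  haveI := compactSpace_subgroup K hK
  rw [subgroupAverage_apply]
  have hc : Continuous fun k : K => η ((k : G)⁻¹ * g₀) :=
    hη.comp ((continuous_subtype_val.inv).mul continuous_const)
  have h1 : (fun k : K => η ((k : G)⁻¹ * g₀)) 1 ≠ 0 := by simp [hg₀.ne']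
  exact hc.integral_pos_of_hasCompactSupport_nonneg_nonzero (HasCompactSupport.of_compactSpace _)
    (fun k => hη0 _) h1

include hK in
/-- **Invariant bump functions.** For a compact subgroup `K` of a locally compact group and an open
set `U ⊇ K` there is a continuous compactly supported `η ≥ 0` on `G`, left `K`-invariant
(`η(k g) = η(g)`), positive at `1`, and vanishing outside `U` (average a Urysohn function over
`K`, after shrinking with `compact_open_separated_mul_right`). [folklore] -/
theorem exists_continuous_invariant_nonneg_pos [LocallyCompactSpace G] [FirstCountableTopology G]
    {U : Set G} (hU : IsOpen U) (hKU : (K : Set G) ⊆ U) :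
    ∃ η : G → ℝ, Continuous η ∧ HasCompactSupport η ∧ 0 ≤ η ∧
      (∀ k ∈ K, ∀ g, η (k * g) = η g) ∧ 0 < η 1 ∧ Function.support η ⊆ U := by
  -- shrink: `K * V ⊆ U` with `V` a neighbourhood of `1`, then a closed neighbourhood `V' ⊆ V`
  obtain ⟨V, hV, hKV⟩ := compact_open_separated_mul_right hK hU hKU
  obtain ⟨V', hV', hV'c, hV'V⟩ := exists_mem_nhds_isClosed_subset hV
  -- a Urysohn function supported in `V'`, equal to `1` at `1`
  obtain ⟨f, hf1, hf0, hfc, hf01⟩ := exists_continuous_one_zero_of_isCompact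
    (isCompact_singleton (x := (1 : G))) (isOpen_interior (s := V')).isClosed_compl
    (by
      rw [Set.disjoint_singleton_left, Set.mem_compl_iff, not_not]
      exact mem_interior_iff_mem_nhds.2 hV')
  have hf_nonneg : 0 ≤ (f : G → ℝ) := fun x => (hf01 x).1
  have hf_supp : tsupport f ⊆ V := by
    refine (closure_minimal (fun x hx => ?_) hV'c).trans hV'V
    by_contra hxV'
    exact hx (hf0 (fun h => hxV' (interior_subset h)))
  refine ⟨subgroupAverage K hK f, continuous_subgroupAverage K hK f.continuous hfc,
    hasCompactSupport_subgroupAverage K hK hfc, subgroupAverage_nonneg K hK hf_nonneg,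
    fun k hk g => subgroupAverage_mul_left K hK f hk g,
    subgroupAverage_pos K hK f.continuous hf_nonneg (by rw [hf1 rfl]; exact one_pos), ?_⟩
  intro g hg
  by_contra hgU
  apply hg
  refine subgroupAverage_eq_zero_of_notMem K hK fun hmem => hgU ?_
  obtain ⟨k, hk, x, hx, rfl⟩ := hmem
  exact hKV ⟨k, hk, x, hf_supp hx, rfl⟩

end Averaging

end

end Literature.NumberTheory.Automorphic
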